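import Summits.QuantumFields.YangMills.Theorems.BalabanUVNodesK0AxJoinTGeomW
import Summits.QuantumFields.YangMills.Theorems.BalabanUVNodesK0AxMomentSocketTight

/-!
# ★ P3 g89 — LENS P3 «weaken the target», sketch №7: JOIN-T ON THE BOX — lens-1's kernel step re-read on BOX HISTORIES with its window threshold EXPOSED
# ⟹ the locally-uniform box edition (E-lu-box) of the two-volume letter (hence (L-lim-box) and the Cauchy half of the junction's continuity row (C), by ✓p817732 ★:258 ∕ ★:240),
# and (E-lu-box) ⟹ [E] along runs (nothing of JOIN-T's run output is lost).
LANDING (porter PTC-1 g3, 2026-08-31): landed VERBATIM from the ideation cell's HOME sketch `nodeO-cover/P3-K0AxJoinTBox-v1.lean` (sha16 b21537a4dbadcef5, 314 l.,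
author seat ★ P3 gen 89, SKETCH∕OFFER №7 09:06:03Z — JOIN-T ON THE BOX; the kernel step it re-targets is ◇ lens-1 g9's ✓`recordTwoVol_of_rows_JC` ∕ ✓`kstep_joinT_at_record[_W]`)
as a K0ᴬ helper `--supports stmt-QuantumFields-27238 --as helper` under the basename the author named (`…K0AxJoinTBox`); only this paragraph was added.  CONDITIONAL
theorems over DISPLAYED rows (all hypotheses), no new `def`; (E-lu-box) ∕ [E] inhabited unconditionally NOWHERE; nothing of [B12]∕[B13] asserted, ported, discharged or refuted;
K0ᴬ (stmt-27238) stays OPEN.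

(unit `ym-nodeO-ideate-p3` GEN 89; HOME sketch `nodeO-cover/P3-K0AxJoinTBox-v1.lean`; nobody's tree file; count-neutral.  Sequel to ✓p817093 `…K0AxJoinTKStep` ∕ ✓`…K0AxJoinTGeomW` (◇ lens-1 g9's JOIN-T §K ∕ §W,
AUTHORSHIP OF THE KERNEL STEP = lens-1; this file only re-quantifies it) and to ✓p817732 `…K0AxMomentSocketTight` (№6 v1.1; (E-lu-box) `RecordPvolTwoVolExpLocUnifOnBoxAx` :217 there).)

[I] = [Balaban1987RG1].

THE LENS-P3 QUESTION THIS FILE ANSWERS (EDGE TABLE v2 §6, STATUS l.4934 ∕ l.4944).  JOIN-T's output [E] = `K0AxTwoVolumeRate.RecordPvolTwoVolExpOnRunsAx` is typed ALONG RUNS with its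
threshold `∃ K₀` AFTER `(gs, k, μ, ν, z)`; it feeds (1.21) along runs (K0ᴬ's RUN doors) and NOT the junction's box rows ((L-lim-box), (C)).  READING OF ✓`K0AxJoinT.recordTwoVol_of_rows_JC`
(JK :152): its `∀ᶠ m in atTop` is `filter_upwards [hwin z]` and nothing else — the member-level two-rate bound holds at EVERY member `m` whose inner window contains `z`
(`∀ l, 2|z l| < Nin m`), for an ARBITRARY history `v`, from ⁸'s mould D1 AT `v` and history-free rows.  Hence:

  ★★★ `recordTwoVol_of_rows_JC_window` — lens-1's ★★★ member-level theorem with the window threshold EXPOSED (hypothesis `hwin` dropped; conclusion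
      `∀ μ ν z m, (∀ l, 2|z l| < Nin m) → |Π^{K₀+m+1}(v) − Π^{K₀+m}(v)|_{μν z} ≤ A·e^{−δ₀·recordRNat∕2} + B·e^{−δ₁·Rsep m}`); PROOF = lens-1's, minus one `filter_upwards` (credit: ◇ lens-1 g9).
  ★   `recordPvolTwoVolExpLocUnifOnBoxAx_of_members_box` — §E's `…_of_members` ON THE BOX: an explicit-window member bound at every box history + (G3) eventual window membership
      (`hwin`, per `(k, z)`, HISTORY-FREE) + (G4) rate rows ⟹ (E-lu-box) at `(A + B, δ₁·cR)` with `t := Box γ k` itself (the threshold `recordK₀ + m₀(k, z)` is uniform on the whole box).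
  ★★★ `recordPvolTwoVolExpLocUnifOnBoxAx_of_rows_box` — `kstep_joinT_at_record` with D1 supplied on BOX histories (`∀ k, ∀ v ∈ Box γ₀ k, FormatPlusG … (recordΦfAx F a₀ ε₂₉ k v (recordK₀+n)) …`)
      instead of along `]0, γ₀]`-runs, every other row VERBATIM ⟹ **(E-lu-box) `RecordPvolTwoVolExpLocUnifOnBoxAx F a₀ ε₂₉ γ₀ (48E₀C₉²K₀′K₁ + 32E₀C₉²e^{δ₁Mg c₁}K₀′K₁) (δ₁·cR)`**.
  ★★★ `recordPvolTwoVolExpLocUnifOnBoxAx_of_rows_box_W` — the same with (G3)(G4) discharged at ✓`…K0AxJoinTGeomW`'s witnesses (`Nin := recordRNat`, `Rsep := recordR∕2 − 2Mc`, `cR := 1∕16`,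
      under `McGuard`): (E-lu-box) at rate `δ₁∕16`.
  ★   `recordPvolTwoVolExpOnRunsAx_of_locUnifOnBox` — ORDER: (E-lu-box) ⟹ [E] along `]0, γ]`-runs (`prefixOf gs k ∈ Box γ k`, ✓`prefixOf_mem_box_of_inInterval`), so the box retarget keeps every
      run door fed (✓`recordPolLimitOnRunsAx_of_twoVolExp`, TV :249).

  ★★★ `record13SepCoPHInhabitedAx_of_twoVolExpBox_pvolAbsMomentBox_cofinalRadii` — the |β|-only BOX door: (E-lu-box) + (V-absmom-box) at cofinally small radii ⟹ K0ᴬ BY NAME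
      ((E-lu-box) ⟹ (L-lim-box), then Fatou through the windows ✓MB :274; the box twin of ✓MS :225).

DOWNSTREAM BY NAME (✓p817732): (E-lu-box) ⟹ (V-lucauchy-box) ★ `recordPvolLocUniformCauchyOnBoxAx_of_twoVolExpLocUnif`, ⟹ (L-lim-box) ★ `polLimitOnBoxOf_of_twoVolExpLocUnif`, and with
(V-absmom-box) + (V-dom-ev-box) + (V-cont-box) + (V-lowtight-box) at cofinal radii ⟹ K0ᴬ ★★★ `record13SepCoPHInhabitedAx_of_twoVolExpBoxLettersTight_cofinalRadii`.  WHAT THE BOX RETARGET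
COSTS UPSTREAM: D1 on the box = ⁸'s consequent `FormatPlusG` at `recordΦfAx F a₀ ε₂₉ k v ·` for every `v ∈ Box γ₀ k` (the (1.19) representation at every box history, [I] Thm 3 p.264
«for all sequences in the box»), where JOIN-T as landed asks it only along the (0.20)-runs; rows D9 ∕ D13 ∕ (G0)–(G4) ∕ leaves are history-free and unchanged.

HONEST FRAMING.  CONDITIONAL theorems over DISPLAYED row predicates (all hypotheses) + bookkeeping; NO `sorry`; nothing of Bałaban ([I] Thm 1, (1.7), (1.18)–(1.22), (4.35)–(4.37),
(5.10)) asserted, ported, discharged or refuted; (E-lu-box) is inhabited unconditionally NOWHERE; K0ᴬ stmt-QuantumFields-27238 ∕ K1ᴬ 27239 ∕ K3ᴬ 27247 OPEN; NODE O 0∕1;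
COUNT 8∕28 · K 1∕4 UNMOVED; finite `𝕋⁴_{L^K}` at fixed ε — NOT continuum ∕ ℝ⁴ ∕ OS ∕ Clay; **the Yang–Mills mass gap is NOT proved by any of this.**  No `instance`, `notation`, `private`;
standard axioms.
-/

noncomputable section

open Filter Topology
open scoped BigOperators Matrix.Norms.L2Operator

namespace Summit.QuantumFields.YangMills.Theorems.K0AxMomentRoad

open Literature.MathematicalPhysics.QuantumFieldTheory.Balaban1983to89
open Literature.MathematicalPhysics.QuantumFieldTheory.Balaban1983to89.Node00 (TermFamily1 siteOfInt polWindow polScalar betaOfRecord₁₃Ax Stage13Params)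
open Literature.MathematicalPhysics.QuantumFieldTheory.Balaban1983to89.T4Continuum (T4Family)
open Literature.MathematicalPhysics.QuantumFieldTheory.Balaban1983to89.B12FormatPlus
open Literature.MathematicalPhysics.QuantumFieldTheory.Balaban1983to89.B12Decay510 (SiteGeometry GeomLeaf CubeSumLeaf TreeLeaf KernelBound delta1 mixedDeriv
  sum_abs_le delta1_le_half delta1_mul_le delta1_nonneg)
open Literature.MathematicalPhysics.QuantumFieldTheory.Balaban1983to89.B12Decay510TwoVolume (kernelBound_twoVolume_of_gauge mixedDeriv_nextMember_eq maskKernel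
  sum_filter_abs_eq_sum_abs_maskKernel comapLabels abs_sum_next_sub_sum_le_three)
open Summit.QuantumFields.YangMills.Theorems.K0RecordFormatNames (ΦfOf pvolOf plimOf)
open Summit.QuantumFields.YangMills.Theorems.PortH (exists_cutTo_clm pvolOf_eq_trace)
open Summit.QuantumFields.YangMills.Theorems.K0RecordFormatNames
open Summit.QuantumFields.YangMills.Theorems.K0AxTwoVolumeRate (RecordPvolTwoVolExpOnRunsAx)
open Summit.QuantumFields.YangMills.Theorems.PortHRecordJoin (formatPlusG_chartSwap chartEquivariant_members noInvariantCovector_members chart_cut)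
open Summit.QuantumFields.YangMills.Theorems.K0PortChart44DAtRecord (chart44DJ_record)
open Summit.QuantumFields.YangMills.Theorems.K0AxJoinT
open Literature.MathematicalPhysics.QuantumFieldTheory.Balaban1983to89.FlowStep
open Literature.MathematicalPhysics.QuantumFieldTheory.Balaban1983to89.FlowStepRuns

/-! ## §9a  The member level with the window threshold exposed (lens-1's ★★★, re-quantified) -/

/-- ★★★ **MEMBER LEVEL, WINDOW THRESHOLD EXPOSED** — ✓`K0AxJoinT.recordTwoVol_of_rows_JC` (◇ lens-1 g9, ✓p817093 :152) VERBATIM except that the eventual-membership row `hwin` is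
dropped and the conclusion holds at EVERY member `m` whose inner window contains `z` (`∀ l, 2|z l| < Nin m`): the history `v` is ARBITRARY and enters only through ⁸'s mould (D1 at `v`);
the threshold is history-free.  Proof = lens-1's (★★★ `twoVol_pvolOf_of_rows_trace` at the record names via `flipJC`), minus one `filter_upwards`.  CONDITIONAL over displayed rows;
nothing of Bałaban asserted. [cite: Balaban1987RG1, (1.21) p.264, (1.18)–(1.19) p.263, (1.7) p.261, (4.14) p.284, (4.35)–(4.37) pp.290–291, (5.10) p.293; Balaban1985Variational, Prop. 9 p.309] -/
theorem recordTwoVol_of_rows_JC_window {E₀ κ C₉ δ₀ Mg c₁ K₀' K₁ : ℝ}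
    (hE₀ : 0 ≤ E₀) (hκ : 0 < κ) (hC₉ : 0 ≤ C₉) (hδ₀ : 0 < δ₀) (hMg : 0 < Mg) (hK₀' : 0 ≤ K₀') :
    ∀ (F : T4Family) (a₀ ε₂₉ α₀ α₁ : ℝ), 0 < α₀ → 0 < α₁ → ∀ (Mc k : ℕ) (v : Fin (k + 1) → ℝ) (Nin : ℕ → ℕ) (Rsep : ℕ → ℝ),
      letI θ := thetaFill F a₀ ε₂₉; letI := θ.instVβ₁; letI := θ.instVβ₂; letI := θ.instιβ
      ∀ ιC : (n : ℕ) → recordW F a₀ ε₂₉ k (recordK₀ F Mc k + n) → (Fin (recordChartDimJ F (recordK₀ F Mc k + n)) → ℂ),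
      B12FormatPlus.FormatPlusG (fun n => recordDomSys F Mc k (recordK₀ F Mc k + n)) (fun n => recordBondCount F (recordK₀ F Mc k + n))
          (fun n => recordAct F (recordK₀ F Mc k + n)) (fun n => recordUc F Mc k α₀ α₁ (recordK₀ F Mc k + n))
          (fun n => recordCoords F Mc k (recordK₀ F Mc k + n)) (fun n => recordChartDimJ F (recordK₀ F Mc k + n))
          (fun n => recordChartJ F Mc k (recordK₀ F Mc k + n)) (fun n => recordΦfAx F a₀ ε₂₉ k v (recordK₀ F Mc k + n))
          (fun n => recordEmbJ F θ k (recordK₀ F Mc k + n)) (fun n => recordWrapCtr F Mc k (recordK₀ F Mc k + n))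
          (fun n => recordDomEmbCtr F Mc k (recordK₀ F Mc k + n)) (fun n _ => recordCoordProjCtr F (recordK₀ F Mc k + n)) E₀ κ →
      (∀ n : ℕ, ∀ᶠ B in 𝓝 (0 : recordW F a₀ ε₂₉ k (recordK₀ F Mc k + n)), ∀ X : (recordDomSys F Mc k (recordK₀ F Mc k + n)).Dom,
          ∃ g : recordGaugeGrp F (recordK₀ F Mc k + n), ∀ i ∈ recordCoords F Mc k (recordK₀ F Mc k + n) X,
            recordChartJ F Mc k (recordK₀ F Mc k + n) X (ιC n B) i =
              recordAct F (recordK₀ F Mc k + n) g (recordChartJ F Mc k (recordK₀ F Mc k + n) X (recordEmbJ F θ k (recordK₀ F Mc k + n) B)) i) →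
      (∀ a : θ.ιβ, Response9DAtJC F θ a Mc k (recordK₀ F Mc k) (min (1 / 4 : ℝ) (min α₁ (α₀ / 36))) C₉ δ₀) →
      (∀ n : ℕ, ContDiffAt ℝ 2 (ιC n) 0 ∧ ιC n 0 = 0) →
      (∀ (n : ℕ) (a : θ.ιβ) (l : RespLabel F k (recordK₀ F Mc k + n)),
          recordGkJC F θ k (recordK₀ F Mc k + n) a l = fun i => fderiv ℝ (ιC n) 0 (Pi.single l.1 (Pi.single l.2 (θ.bV a))) i) →
      (∀ n : ℕ, Set.InjOn (recordDomEmbCtr F Mc k (recordK₀ F Mc k + n)) {X | X ∉ recordWrapCtr F Mc k (recordK₀ F Mc k + n)}) →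
      (∀ (n : ℕ) (X : (recordDomSys F Mc k (recordK₀ F Mc k + n)).Dom), X ∈ recordWrapCtr F Mc k (recordK₀ F Mc k + n) →
          ∀ (μ : Fin 4) (z : Fin 4 → ℤ), (∀ l, 2 * |z l| < (Nin n : ℤ)) →
            Rsep n ≤ (recordSiteGeom F Mc k (recordK₀ F Mc k + n)).distD (recordE F k (recordK₀ F Mc k + n) μ z) X +
              Mg * ((recordDomSys F Mc k (recordK₀ F Mc k + n)).dj X + c₁)) →
      (∀ (n : ℕ) (X' : (recordDomSys F Mc k (recordK₀ F Mc k + (n + 1))).Dom),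
          (∀ X, X ∉ recordWrapCtr F Mc k (recordK₀ F Mc k + n) → recordDomEmbCtr F Mc k (recordK₀ F Mc k + n) X ≠ X') →
          ∀ (μ : Fin 4) (z : Fin 4 → ℤ), (∀ l, 2 * |z l| < (Nin n : ℤ)) →
            Rsep n ≤
              (recordSiteGeom F Mc k (recordK₀ F Mc k + (n + 1))).distD (recordE F k (recordK₀ F Mc k + (n + 1)) μ z) X' +
                Mg * ((recordDomSys F Mc k (recordK₀ F Mc k + (n + 1))).dj X' + c₁)) →
      (∀ n : ℕ, Nin n ≤ recordRNat F Mc k (recordK₀ F Mc k + n)) →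
      (∀ n : ℕ, B12Decay510.CubeSumLeaf (recordSiteGeom F Mc k (recordK₀ F Mc k + n)) (δ₀ / 4) K₁ ∧
          B12Decay510.TreeLeaf (recordCc F Mc k (recordK₀ F Mc k + n)) (κ / 4) K₀') →
      ∀ (μ ν : Fin 4) (z : Fin 4 → ℤ) (m : ℕ), (∀ l, 2 * |z l| < (Nin m : ℤ)) →
        |recordPvolAx F a₀ ε₂₉ k v (recordK₀ F Mc k + (m + 1)) μ ν z - recordPvolAx F a₀ ε₂₉ k v (recordK₀ F Mc k + m) μ ν z| ≤
          48 * E₀ * C₉ ^ 2 * K₀' * K₁ * Real.exp (-δ₀ * (recordRNat F Mc k (recordK₀ F Mc k + m) : ℝ) / 2) +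
            32 * E₀ * C₉ ^ 2 * Real.exp (B12Decay510.delta1 δ₀ κ Mg * Mg * c₁) * K₀' * K₁ *
              Real.exp (-(B12Decay510.delta1 δ₀ κ Mg) * Rsep m) := by
  classical
  intro F a₀ ε₂₉ α₀ α₁ hα₀ hα₁ Mc k v Nin Rsep ιC hFmt hsw hResp hreg hGk hinj hsepW hsepF hNin hleaf μ ν z m hm
  letI θ := thetaFill F a₀ ε₂₉; letI := θ.instVβ₁; letI := θ.instVβ₂; letI := θ.instιβ
  have hFmtC := formatPlusG_chartSwap hFmt hsw
  have hnegW : ∀ (n : ℕ) (z : Fin 4 → ℤ), (∀ l, 2 * |z l| < (Nin n : ℤ)) → ∀ l, 2 * |(-z) l| < (Nin n : ℤ) := fun n z hz l => by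
    simpa only [Pi.neg_apply, abs_neg] using hz l
  refine twoVol_pvolOf_of_rows_trace F (recordTermsAx F a₀ ε₂₉) θ.ρ8 θ.bV k v
    (fun n => recordUc F Mc k α₀ α₁ (recordK₀ F Mc k + n)) (fun n => recordCoords F Mc k (recordK₀ F Mc k + n))
    (fun n => recordChartJ F Mc k (recordK₀ F Mc k + n))
    (fun n X => recordDom44J F Mc k (recordK₀ F Mc k + n) X (min (1 / 4 : ℝ) (min α₁ (α₀ / 36))))
    (fun n => recordAct F (recordK₀ F Mc k + n)) (fun n => recordToG F (recordK₀ F Mc k + n)) (fun n => recordAdJ F (recordK₀ F Mc k + n))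
    (flipJC F θ (recordAStar F a₀ ε₂₉) Mc k (recordK₀ F Mc k)) (fun n => recordK₀ F Mc k + n)
    (fun n a (y : RespLabel F k (recordK₀ F Mc k + n)) => recordGkJC F θ k (recordK₀ F Mc k + n) a y) ιC
    (N := fun n => recordRNat F Mc k (recordK₀ F Mc k + n)) (Nin := Nin) (Rsep := Rsep) (K₁ := K₁)
    hE₀ hκ.le hC₉ hδ₀.le hMg hK₀' hFmtC (chart44DJ_record F Mc k hα₀ hα₁)
    (chartEquivariant_members Mc k (recordK₀ F Mc k)) (noInvariantCovector_members (recordK₀ F Mc k))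
    (chart_cut_members_JC F θ (recordAStar F a₀ ε₂₉) Mc k (recordK₀ F Mc k) _)
    ?_ ?_ ?_ ?_ hinj hNin ?_ ?_ (fun n => (hleaf n).1) (fun n => (hleaf n).2) ?_ m μ ν z hm
  · exact fun n a X y => (response9D_flipJC F θ a Mc k (recordK₀ F Mc k) (hResp a)).2.2.1 n X y
  · exact (response9D_flipJC F θ (recordAStar F a₀ ε₂₉) Mc k (recordK₀ F Mc k) (hResp _)).2.2.2.1
  · exact fun n a X hX μ' z' hz' => (response9D_flipJC F θ a Mc k (recordK₀ F Mc k) (hResp a)).2.2.2.2.1 n X hX μ' z' hz'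
  · exact (response9D_flipJC F θ (recordAStar F a₀ ε₂₉) Mc k (recordK₀ F Mc k) (hResp _)).2.2.2.2.2
  · intro n X hX μ' z' hz'
    rw [flipJC_e]
    exact hsepW n X hX μ' (-z') (hnegW n z' hz')
  · intro n X' hX' μ' z' hz'
    rw [flipJC_e]
    exact hsepF n X' hX' μ' (-z') (hnegW n z' hz')
  · exact fun n => ⟨(hreg n).2, (hreg n).1, fun a μ' z' => hGk n a _⟩


/-! ## §9b  Members ⟹ the box letter, uniformly on the box -/

/-- ★ **FROM AN EXPLICIT-WINDOW MEMBER BOUND ON THE BOX TO (E-lu-box)** (§E's ✓`recordPvolTwoVolExpOnRunsAx_of_members` ON THE BOX): the two-rate member bound at every box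
history for every member whose inner window holds `z`, the HISTORY-FREE eventual window membership (G3) `hwin` and the rate rows (G4) (`cR·recordN ≤ Rsep`, `recordN∕4 ≤ recordRNat`)
⟹ `RecordPvolTwoVolExpLocUnifOnBoxAx F a₀ ε₂₉ γ (A + B) (δ₁·cR)` with the neighbourhood `t := Box γ k` itself and the threshold `recordK₀ F Mc k + m₀(k, z)` — uniform on the whole
box (`recordN F k K = (F.P K).sitesPerDir (k+1)`, ✓`K0AxJoinT.twoRate_le`). [cite: Balaban1987RG1, (1.21) p.264, (1.7) p.261, (0.20) p.256, Thm 3 p.264] -/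
theorem recordPvolTwoVolExpLocUnifOnBoxAx_of_members_box (F : T4Family) (a₀ ε₂₉ γ : ℝ) (Mc : ℕ) (Nin : ℕ → ℕ → ℕ) (Rsep : ℕ → ℕ → ℝ) {A B δ₀ δ₁ cR : ℝ}
    (hA : 0 ≤ A) (hB : 0 ≤ B) (hδ₁ : 0 < δ₁) (hδ₁δ₀ : δ₁ ≤ δ₀ / 2) (hcR : 0 < cR) (hcR4 : cR ≤ 1 / 4)
    (hNR : ∀ k n, cR * (recordN F k (recordK₀ F Mc k + n) : ℝ) ≤ Rsep k n ∧
      (recordN F k (recordK₀ F Mc k + n) : ℝ) / 4 ≤ (recordRNat F Mc k (recordK₀ F Mc k + n) : ℝ))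
    (hwin : ∀ (k : ℕ) (z : Fin 4 → ℤ), ∀ᶠ n in atTop, ∀ l, 2 * |z l| < (Nin k n : ℤ))
    (h : ∀ (k : ℕ) (v : Fin (k + 1) → ℝ), v ∈ Box γ k → ∀ (μ ν : Fin 4) (z : Fin 4 → ℤ) (m : ℕ), (∀ l, 2 * |z l| < (Nin k m : ℤ)) →
      |recordPvolAx F a₀ ε₂₉ k v (recordK₀ F Mc k + (m + 1)) μ ν z - recordPvolAx F a₀ ε₂₉ k v (recordK₀ F Mc k + m) μ ν z| ≤
        A * Real.exp (-δ₀ * (recordRNat F Mc k (recordK₀ F Mc k + m) : ℝ) / 2) + B * Real.exp (-δ₁ * Rsep k m)) :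
    RecordPvolTwoVolExpLocUnifOnBoxAx F a₀ ε₂₉ γ (A + B) (δ₁ * cR) := by
  refine ⟨by positivity, fun k μ ν z v _ => ⟨Box γ k, self_mem_nhdsWithin, ?_⟩⟩
  obtain ⟨m₀, hm₀⟩ := eventually_atTop.1 (hwin k z)
  refine ⟨recordK₀ F Mc k + m₀, fun K hK w hw => ?_⟩
  obtain ⟨m, rfl⟩ : ∃ m, K = recordK₀ F Mc k + m := ⟨K - recordK₀ F Mc k, by omega⟩
  have hm := h k w hw μ ν z m (hm₀ m (by omega))
  have hs : (((F.P (recordK₀ F Mc k + m)).sitesPerDir (k + 1) : ℕ) : ℝ) = (recordN F k (recordK₀ F Mc k + m) : ℝ) := rfl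
  obtain ⟨hR, h4⟩ := hNR k m
  have hN0 : (0 : ℝ) ≤ recordN F k (recordK₀ F Mc k + m) := Nat.cast_nonneg _
  rw [← add_assoc] at hm
  refine hm.trans ?_
  rw [hs]
  refine twoRate_le hA hB ?_ ?_
  · have h₁ : δ₁ * cR ≤ δ₀ / 8 := by nlinarith
    have h₂ : δ₁ * cR * (recordN F k (recordK₀ F Mc k + m) : ℝ) ≤ δ₀ / 8 * (recordN F k (recordK₀ F Mc k + m) : ℝ) :=
      mul_le_mul_of_nonneg_right h₁ hN0
    nlinarith
  · have h₂ : δ₁ * (cR * (recordN F k (recordK₀ F Mc k + m) : ℝ)) ≤ δ₁ * Rsep k m := mul_le_mul_of_nonneg_left hR hδ₁.le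
    nlinarith

/-! ## §9c  The kernel step with D1 on the box ⟹ (E-lu-box) -/

/-- ★★★ **`kstep` ON THE BOX** — ✓`K0AxJoinT.kstep_joinT_at_record` (◇ lens-1 g9, ✓p817093 :231) with ⁸'s mould D1 supplied at EVERY BOX HISTORY `v ∈ Box γ₀ k`
(`FormatPlusG … (recordΦfAx F a₀ ε₂₉ k v (recordK₀+n)) …`) instead of along `]0, γ₀]`-runs; the swap row, D9 `Response9DAtJC`, D13 identities, (G0)–(G4), leaves VERBATIM
⟹ **(E-lu-box)** `RecordPvolTwoVolExpLocUnifOnBoxAx F a₀ ε₂₉ γ₀ (48E₀C₉²K₀′K₁ + 32E₀C₉²e^{δ₁Mg c₁}K₀′K₁) (δ₁·cR)`, `δ₁ = delta1 δ₀ κ Mg` — the letter that feeds (L-lim-box) and the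
Cauchy half of (C) at the K0ᴬ–K1ᴬ junction (✓p817732 ★:258 ∕ ★:240).  CONDITIONAL: every displayed row is a hypothesis; (E-lu-box) inhabited unconditionally NOWHERE; nothing of Bałaban
asserted; K0ᴬ 27238 OPEN; the Yang–Mills mass gap is NOT proved.
[cite: Balaban1987RG1, Thm 1 p.259, Thm 3 p.264, (0.20) p.256, (1.7) p.261, (1.18)–(1.22) pp.263–264, (4.4)–(4.5) pp.281–282, (4.14) p.284, (4.35)–(4.37) pp.290–291; Balaban1985Variational, Prop. 9 p.309] -/
theorem recordPvolTwoVolExpLocUnifOnBoxAx_of_rows_box {E₀ κ C₉ δ₀ Mg c₁ K₀' K₁ : ℝ}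
    (hE₀ : 0 ≤ E₀) (hκ : 0 < κ) (hC₉ : 0 ≤ C₉) (hδ₀ : 0 < δ₀) (hMg : 0 < Mg) (hK₀' : 0 ≤ K₀') :
    ∀ (F : T4Family) (a₀ ε₂₉ γ₀ α₀ α₁ : ℝ), 0 < α₀ → 0 < α₁ → ∀ (Mc : ℕ) (Nin : ℕ → ℕ → ℕ) (Rsep : ℕ → ℕ → ℝ) (cR : ℝ), 0 < cR → cR ≤ 1 / 4 →
      letI θ := thetaFill F a₀ ε₂₉; letI := θ.instVβ₁; letI := θ.instVβ₂; letI := θ.instιβ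
      ∀ ιC : (k n : ℕ) → recordW F a₀ ε₂₉ k (recordK₀ F Mc k + n) → (Fin (recordChartDimJ F (recordK₀ F Mc k + n)) → ℂ),
      (∀ (k : ℕ) (v : Fin (k + 1) → ℝ), v ∈ FlowStep.Box γ₀ k →
        B12FormatPlus.FormatPlusG (fun n => recordDomSys F Mc k (recordK₀ F Mc k + n)) (fun n => recordBondCount F (recordK₀ F Mc k + n))
          (fun n => recordAct F (recordK₀ F Mc k + n)) (fun n => recordUc F Mc k α₀ α₁ (recordK₀ F Mc k + n))
          (fun n => recordCoords F Mc k (recordK₀ F Mc k + n)) (fun n => recordChartDimJ F (recordK₀ F Mc k + n))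
          (fun n => recordChartJ F Mc k (recordK₀ F Mc k + n)) (fun n => recordΦfAx F a₀ ε₂₉ k v (recordK₀ F Mc k + n))
          (fun n => recordEmbJ F θ k (recordK₀ F Mc k + n)) (fun n => recordWrapCtr F Mc k (recordK₀ F Mc k + n))
          (fun n => recordDomEmbCtr F Mc k (recordK₀ F Mc k + n)) (fun n _ => recordCoordProjCtr F (recordK₀ F Mc k + n)) E₀ κ) →
      (∀ (k n : ℕ), ∀ᶠ B in 𝓝 (0 : recordW F a₀ ε₂₉ k (recordK₀ F Mc k + n)), ∀ X : (recordDomSys F Mc k (recordK₀ F Mc k + n)).Dom,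
          ∃ g : recordGaugeGrp F (recordK₀ F Mc k + n), ∀ i ∈ recordCoords F Mc k (recordK₀ F Mc k + n) X,
            recordChartJ F Mc k (recordK₀ F Mc k + n) X (ιC k n B) i =
              recordAct F (recordK₀ F Mc k + n) g (recordChartJ F Mc k (recordK₀ F Mc k + n) X (recordEmbJ F θ k (recordK₀ F Mc k + n) B)) i) →
      (∀ k : ℕ, (∀ a : θ.ιβ, Response9DAtJC F θ a Mc k (recordK₀ F Mc k) (min (1 / 4 : ℝ) (min α₁ (α₀ / 36))) C₉ δ₀) ∧
          (∀ n : ℕ, ContDiffAt ℝ 2 (ιC k n) 0 ∧ ιC k n 0 = 0) ∧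
          ∀ (n : ℕ) (a : θ.ιβ) (l : RespLabel F k (recordK₀ F Mc k + n)),
            recordGkJC F θ k (recordK₀ F Mc k + n) a l = fun i => fderiv ℝ (ιC k n) 0 (Pi.single l.1 (Pi.single l.2 (θ.bV a))) i) →
      (∀ k n : ℕ, Set.InjOn (recordDomEmbCtr F Mc k (recordK₀ F Mc k + n)) {X | X ∉ recordWrapCtr F Mc k (recordK₀ F Mc k + n)}) →
      (∀ (k n : ℕ) (X : (recordDomSys F Mc k (recordK₀ F Mc k + n)).Dom), X ∈ recordWrapCtr F Mc k (recordK₀ F Mc k + n) →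
          ∀ (μ : Fin 4) (z : Fin 4 → ℤ), (∀ l, 2 * |z l| < (Nin k n : ℤ)) →
            Rsep k n ≤ (recordSiteGeom F Mc k (recordK₀ F Mc k + n)).distD (recordE F k (recordK₀ F Mc k + n) μ z) X +
              Mg * ((recordDomSys F Mc k (recordK₀ F Mc k + n)).dj X + c₁)) →
      (∀ (k n : ℕ) (X' : (recordDomSys F Mc k (recordK₀ F Mc k + (n + 1))).Dom),
          (∀ X, X ∉ recordWrapCtr F Mc k (recordK₀ F Mc k + n) → recordDomEmbCtr F Mc k (recordK₀ F Mc k + n) X ≠ X') →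
          ∀ (μ : Fin 4) (z : Fin 4 → ℤ), (∀ l, 2 * |z l| < (Nin k n : ℤ)) →
            Rsep k n ≤
              (recordSiteGeom F Mc k (recordK₀ F Mc k + (n + 1))).distD (recordE F k (recordK₀ F Mc k + (n + 1)) μ z) X' +
                Mg * ((recordDomSys F Mc k (recordK₀ F Mc k + (n + 1))).dj X' + c₁)) →
      (∀ k n : ℕ, Nin k n ≤ recordRNat F Mc k (recordK₀ F Mc k + n)) → (∀ (k : ℕ) (z : Fin 4 → ℤ), ∀ᶠ n in atTop, ∀ l, 2 * |z l| < (Nin k n : ℤ)) →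
      (∀ k n : ℕ, cR * (recordN F k (recordK₀ F Mc k + n) : ℝ) ≤ Rsep k n ∧
          (recordN F k (recordK₀ F Mc k + n) : ℝ) / 4 ≤ (recordRNat F Mc k (recordK₀ F Mc k + n) : ℝ)) →
      (∀ k n : ℕ, B12Decay510.CubeSumLeaf (recordSiteGeom F Mc k (recordK₀ F Mc k + n)) (δ₀ / 4) K₁ ∧
          B12Decay510.TreeLeaf (recordCc F Mc k (recordK₀ F Mc k + n)) (κ / 4) K₀') →
      RecordPvolTwoVolExpLocUnifOnBoxAx F a₀ ε₂₉ γ₀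
        (48 * E₀ * C₉ ^ 2 * K₀' * K₁ + 32 * E₀ * C₉ ^ 2 * Real.exp (B12Decay510.delta1 δ₀ κ Mg * Mg * c₁) * K₀' * K₁) (B12Decay510.delta1 δ₀ κ Mg * cR) := by
  intro F a₀ ε₂₉ γ₀ α₀ α₁ hα₀ hα₁ Mc Nin Rsep cR hcR hcR4 ιC h8 hsw h9 hinj hsepW hsepF hNin hwin hNR hleaf
  have hK₁ : 0 ≤ K₁ :=
    (Finset.sum_nonneg fun c _ => (Real.exp_pos _).le).trans ((hleaf 0 0).1 (recordE F 0 (recordK₀ F Mc 0 + 0) 0 0))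
  have hA : 0 ≤ 48 * E₀ * C₉ ^ 2 * K₀' * K₁ := by positivity
  have hB : 0 ≤ 32 * E₀ * C₉ ^ 2 * Real.exp (B12Decay510.delta1 δ₀ κ Mg * Mg * c₁) * K₀' * K₁ := by positivity
  exact recordPvolTwoVolExpLocUnifOnBoxAx_of_members_box F a₀ ε₂₉ γ₀ Mc Nin Rsep hA hB (B12Decay510.delta1_pos hδ₀ hκ hMg)
    (B12Decay510.delta1_le_half δ₀ κ Mg) hcR hcR4 hNR hwin fun k v hv μ ν z m hm =>
      recordTwoVol_of_rows_JC_window hE₀ hκ hC₉ hδ₀ hMg hK₀' F a₀ ε₂₉ α₀ α₁ hα₀ hα₁ Mc k v (Nin k) (Rsep k) (ιC k)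
        (h8 k v hv) (hsw k) (h9 k).1 (h9 k).2.1 (h9 k).2.2 (hinj k) (hsepW k) (hsepF k) (hNin k) (hleaf k) μ ν z m hm

/-- ★★★ **`kstep` ON THE BOX WITH THE (G3)(G4) WITNESSES DISCHARGED** — ✓`K0AxJoinT.kstep_joinT_at_record_W` (✓`…K0AxJoinTGeomW`: `Nin := recordRNat`, `Rsep := recordR∕2 − 2·Mc`,
`cR := 1∕16`, under `McGuard`) with D1 supplied at every BOX history; the swap row · D9 + D13 · (G0) · (G1)(G2) AT THE WITNESSES · leaves VERBATIM ⟹ **(E-lu-box) at rate `δ₁∕16`**.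
What remains displayed is exactly what remains for JOIN-T itself ((G0) ✓`…K0AxJoinTGeomA`; (G1)(G2) hand geomB) PLUS D1's box domain.  CONDITIONAL; nothing of Bałaban asserted.
[cite: Balaban1987RG1, Thm 1 p.257, Thm 3 p.264, (1.18)–(1.21) pp.263–264, (1.7) p.261] -/
theorem recordPvolTwoVolExpLocUnifOnBoxAx_of_rows_box_W {E₀ κ C₉ δ₀ Mg c₁ K₀' K₁ : ℝ}
    (hE₀ : 0 ≤ E₀) (hκ : 0 < κ) (hC₉ : 0 ≤ C₉) (hδ₀ : 0 < δ₀) (hMg : 0 < Mg) (hK₀' : 0 ≤ K₀') :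
    ∀ (F : T4Family) (a₀ ε₂₉ γ₀ α₀ α₁ : ℝ), 0 < α₀ → 0 < α₁ → ∀ (Mc : ℕ), McGuard F Mc →
      letI θ := thetaFill F a₀ ε₂₉; letI := θ.instVβ₁; letI := θ.instVβ₂; letI := θ.instιβ
      ∀ ιC : (k n : ℕ) → recordW F a₀ ε₂₉ k (recordK₀ F Mc k + n) → (Fin (recordChartDimJ F (recordK₀ F Mc k + n)) → ℂ),
      (∀ (k : ℕ) (v : Fin (k + 1) → ℝ), v ∈ FlowStep.Box γ₀ k →
        B12FormatPlus.FormatPlusG (fun n => recordDomSys F Mc k (recordK₀ F Mc k + n)) (fun n => recordBondCount F (recordK₀ F Mc k + n))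
          (fun n => recordAct F (recordK₀ F Mc k + n)) (fun n => recordUc F Mc k α₀ α₁ (recordK₀ F Mc k + n))
          (fun n => recordCoords F Mc k (recordK₀ F Mc k + n)) (fun n => recordChartDimJ F (recordK₀ F Mc k + n))
          (fun n => recordChartJ F Mc k (recordK₀ F Mc k + n)) (fun n => recordΦfAx F a₀ ε₂₉ k v (recordK₀ F Mc k + n))
          (fun n => recordEmbJ F θ k (recordK₀ F Mc k + n)) (fun n => recordWrapCtr F Mc k (recordK₀ F Mc k + n))
          (fun n => recordDomEmbCtr F Mc k (recordK₀ F Mc k + n)) (fun n _ => recordCoordProjCtr F (recordK₀ F Mc k + n)) E₀ κ) →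
      (∀ (k n : ℕ), ∀ᶠ B in 𝓝 (0 : recordW F a₀ ε₂₉ k (recordK₀ F Mc k + n)), ∀ X : (recordDomSys F Mc k (recordK₀ F Mc k + n)).Dom,
          ∃ g : recordGaugeGrp F (recordK₀ F Mc k + n), ∀ i ∈ recordCoords F Mc k (recordK₀ F Mc k + n) X,
            recordChartJ F Mc k (recordK₀ F Mc k + n) X (ιC k n B) i =
              recordAct F (recordK₀ F Mc k + n) g (recordChartJ F Mc k (recordK₀ F Mc k + n) X (recordEmbJ F θ k (recordK₀ F Mc k + n) B)) i) →
      (∀ k : ℕ, (∀ a : θ.ιβ, Response9DAtJC F θ a Mc k (recordK₀ F Mc k) (min (1 / 4 : ℝ) (min α₁ (α₀ / 36))) C₉ δ₀) ∧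
          (∀ n : ℕ, ContDiffAt ℝ 2 (ιC k n) 0 ∧ ιC k n 0 = 0) ∧
          ∀ (n : ℕ) (a : θ.ιβ) (l : RespLabel F k (recordK₀ F Mc k + n)),
            recordGkJC F θ k (recordK₀ F Mc k + n) a l = fun i => fderiv ℝ (ιC k n) 0 (Pi.single l.1 (Pi.single l.2 (θ.bV a))) i) →
      (∀ k n : ℕ, Set.InjOn (recordDomEmbCtr F Mc k (recordK₀ F Mc k + n)) {X | X ∉ recordWrapCtr F Mc k (recordK₀ F Mc k + n)}) →
      (∀ (k n : ℕ) (X : (recordDomSys F Mc k (recordK₀ F Mc k + n)).Dom), X ∈ recordWrapCtr F Mc k (recordK₀ F Mc k + n) →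
          ∀ (μ : Fin 4) (z : Fin 4 → ℤ), (∀ l, 2 * |z l| < (recordRNat F Mc k (recordK₀ F Mc k + n) : ℤ)) →
            recordR F Mc k (recordK₀ F Mc k + n) / 2 - 2 * (Mc : ℝ) ≤
              (recordSiteGeom F Mc k (recordK₀ F Mc k + n)).distD (recordE F k (recordK₀ F Mc k + n) μ z) X +
                Mg * ((recordDomSys F Mc k (recordK₀ F Mc k + n)).dj X + c₁)) →
      (∀ (k n : ℕ) (X' : (recordDomSys F Mc k (recordK₀ F Mc k + (n + 1))).Dom),
          (∀ X, X ∉ recordWrapCtr F Mc k (recordK₀ F Mc k + n) → recordDomEmbCtr F Mc k (recordK₀ F Mc k + n) X ≠ X') →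
          ∀ (μ : Fin 4) (z : Fin 4 → ℤ), (∀ l, 2 * |z l| < (recordRNat F Mc k (recordK₀ F Mc k + n) : ℤ)) →
            recordR F Mc k (recordK₀ F Mc k + n) / 2 - 2 * (Mc : ℝ) ≤
              (recordSiteGeom F Mc k (recordK₀ F Mc k + (n + 1))).distD (recordE F k (recordK₀ F Mc k + (n + 1)) μ z) X' +
                Mg * ((recordDomSys F Mc k (recordK₀ F Mc k + (n + 1))).dj X' + c₁)) →
      (∀ k n : ℕ, B12Decay510.CubeSumLeaf (recordSiteGeom F Mc k (recordK₀ F Mc k + n)) (δ₀ / 4) K₁ ∧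
          B12Decay510.TreeLeaf (recordCc F Mc k (recordK₀ F Mc k + n)) (κ / 4) K₀') →
      RecordPvolTwoVolExpLocUnifOnBoxAx F a₀ ε₂₉ γ₀
        (48 * E₀ * C₉ ^ 2 * K₀' * K₁ + 32 * E₀ * C₉ ^ 2 * Real.exp (B12Decay510.delta1 δ₀ κ Mg * Mg * c₁) * K₀' * K₁)
        (B12Decay510.delta1 δ₀ κ Mg * (1 / 16)) := by
  intro F a₀ ε₂₉ γ₀ α₀ α₁ hα₀ hα₁ Mc hMc ιC h8 hsw h9 hinj hsepW hsepF hleaf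
  exact recordPvolTwoVolExpLocUnifOnBoxAx_of_rows_box hE₀ hκ hC₉ hδ₀ hMg hK₀' F a₀ ε₂₉ γ₀ α₀ α₁ hα₀ hα₁ Mc
    (fun k n => recordRNat F Mc k (recordK₀ F Mc k + n)) (fun k n => recordR F Mc k (recordK₀ F Mc k + n) / 2 - 2 * (Mc : ℝ)) (1 / 16)
    (by norm_num) (by norm_num) ιC h8 hsw h9 hinj hsepW hsepF (fun k n => le_rfl) (fun k z => eventually_window_recordRNat hMc k z)
    (fun k n => rateRows_recordW hMc k n) hleaf

/-! ## §9d  ORDER: the box letter dominates the run letter -/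

/-- ★ **(E-lu-box) ⟹ [E] ALONG RUNS** (level `γ`): the prefix of a `]0, γ]`-run is a box history (✓`prefixOf_mem_box_of_inInterval`); take the box letter's threshold at it with
`w := prefixOf gs k`.  So the box retarget loses none of JOIN-T's run consequences ((1.21) along runs, ✓`K0AxTwoVolumeRate.recordPolLimitOnRunsAx_of_twoVolExp`).
[cite: Balaban1987RG1, (1.21) p.264, (0.20) p.256, Thm 3 p.264] -/
theorem recordPvolTwoVolExpOnRunsAx_of_locUnifOnBox (F : T4Family) (a₀ ε₂₉ : ℝ) {γ E₀ κ : ℝ}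
    (h : RecordPvolTwoVolExpLocUnifOnBoxAx F a₀ ε₂₉ γ E₀ κ) : RecordPvolTwoVolExpOnRunsAx F a₀ ε₂₉ γ E₀ κ := by
  refine ⟨h.1, fun n gs _ hI k hk μ ν z => ?_⟩
  have hv : prefixOf gs k ∈ Box γ k := prefixOf_mem_box_of_inInterval hI hk
  obtain ⟨t, ht, K₀, hK⟩ := h.2 k μ ν z (prefixOf gs k) hv
  exact ⟨K₀, fun K hKK => hK K hKK _ (mem_of_mem_nhdsWithin hv ht)⟩

/-! ## §9e  The |β|-only BOX door headed by the box two-volume letter (the box twin of ✓`…K0AxMomentBoxSocket` :225) -/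

/-- ★★★ **THE COFINAL-RADII K0ᴬ DOOR HEADED BY (E-lu-box), |β| ROWS ONLY**: at cofinally small radii, (E-lu-box) at level `γ₀ ≤ ½` ∧ (V-absmom-box)
`RecordPvolAbsMomentOnBoxAx … γ₀ M` ⟹ K0ᴬ BY NAME — (E-lu-box) ⟹ (L-lim-box) (✓p817732 ★ `polLimitOnBoxOf_of_twoVolExpLocUnif` :258), then ✓`K0AxMomentRoad.record13SepCoPHInhabitedAx_of_k0PvolAbsMomentBoxCofinalRadiiAx`
(Fatou through the windows, MB :274).  The box twin of ✓`record13SepCoPHInhabitedAx_of_twoVolExp_pvolAbsMoment_cofinalRadii` (runs); no continuity ∕ floor letter (those are the junction's, ✓p817732 ★★★ :274).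
CONDITIONAL helper; K0ᴬ OPEN; the mass gap is NOT proved. [cite: Balaban1987RG1, Thm 1 p.259, Thm 3 p.264, (0.20) p.256, (1.7) p.261, (1.21)–(1.22) p.264, (4.37) p.291, (5.42) p.297] -/
theorem record13SepCoPHInhabitedAx_of_twoVolExpBox_pvolAbsMomentBox_cofinalRadii
    (H : ∀ F : T4Family, ∀ a : ℝ, 0 < a → ∃ a₀ : ℝ, 0 < a₀ ∧ a₀ ≤ a ∧ ∃ γ₀ ε₂₉ E₀ κ M : ℝ, 0 < γ₀ ∧ γ₀ ≤ 1 / 2 ∧ 0 < ε₂₉ ∧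
      RecordPvolTwoVolExpLocUnifOnBoxAx F a₀ ε₂₉ γ₀ E₀ κ ∧ RecordPvolAbsMomentOnBoxAx F a₀ ε₂₉ γ₀ M) :
    Summit.QuantumFields.YangMills.Theses.BalabanUVNodes.Record13SepCoPHInhabitedAx := by
  refine record13SepCoPHInhabitedAx_of_k0PvolAbsMomentBoxCofinalRadiiAx fun F a ha => ?_
  obtain ⟨a₀, ha₀, hle, γ₀, ε₂₉, E₀, κ, M, hγ₀, hγh, hε, hEx, hV⟩ := H F a ha
  exact ⟨a₀, ha₀, hle, γ₀, ε₂₉, M, hγ₀, hγh, hε, polLimitOnBoxOf_of_twoVolExpLocUnif F a₀ ε₂₉ hEx, hV⟩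

-- standard axioms only (the ★★★ theorems)
#print axioms recordTwoVol_of_rows_JC_window
#print axioms recordPvolTwoVolExpLocUnifOnBoxAx_of_rows_box
#print axioms recordPvolTwoVolExpLocUnifOnBoxAx_of_rows_box_W
#print axioms record13SepCoPHInhabitedAx_of_twoVolExpBox_pvolAbsMomentBox_cofinalRadii

end Summit.QuantumFields.YangMills.Theorems.K0AxMomentRoad

end
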